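import Summits.Ventures.Crystal3D.Theorems.StickyWulffConstantTextureLiminfTexShadowInnerFaceLattice
import Summits.Ventures.Crystal3D.Theorems.StickyWulffConstantGenericWallFloorAffineSampleDeficit
import HarnessLib

/-!
# TexShadow glue (a): the INNER-FACE count `φ(A⁻¹e₃)·πρ² ≤ ½·innerBonds + 30√2π·ρ` for both clamped fcc plates, and the
# ADHESION ⇒ `BilayerWallAt` currency conversion at explicit `(C, R₀)` (lane T, crux `TextureLiminf`, stmt-Ventures-19483;
# line `TexShadow` v6.17, cf-p1 DECISIONS (xlv′)/(xlv″))

HONEST FRAMING. Venture `Summits/Ventures/Crystal3D` (cell `crystal3d-full`), helper `--supports` the crux `TextureLiminf`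
(stmt-Ventures-19483) of `route-Ventures-StickyWulffConstant`, registered line `TexShadow`.  Rung credit only; F-C1 not moved.
Pure proofs, standard axioms, no new definitions.

Lane T's wall cell `BilayerWallAt C R₀ σ₁ σ₂ L₁ L₂ s₁ s₂ c` (…TexShadowWallDefs) reads
`cross₁ + cross₂ ≤ D(Y) + ½·innerBonds₁ + ½·innerBonds₂ − Σ' c_ij·|slice ∩ slab₁ i ∩ slab₂ j| + C(1+h)ρ`, whereas lane F's
`CoaxialTwoSlabAdhesion` (…CoaxialWallLawWallLedgerFDefs) and lane G's `TwoSlabLedgerAt` conclude, for AFFINE fcc plates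
`(Aᵢ·Λ₀ + tᵢ)`, `cross₁ + cross₂ ≤ D(Y) + (φ₁ + φ₂ − q)πρ² + C(1+h)ρ` (`q = ½ sin θ`, resp. the class charge).  For `BothFcc`
plate pairs (…TexShadowBothFccDefs: `stacking Lᵢ sᵢ σᵢ = (Aᵢ· + sᵢ) '' Λ₀`) the two currencies differ by exactly two facts:
(a) `φᵢπρ² ≤ ½·innerBondsᵢ + O(ρ)` — THIS FILE — and (b) `Σ' c_ij·vol ≤ q·πρ²` (…TexShadowCoaxialCharge, p672184).

* `innerBonds_image_of_isometry` — `innerBonds` is transported by a rigid motion (image of the stacking, image of the plate,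
  pulled-back `beyond`);
* `innerBonds_affine_window` — for a moved lattice `A·Λ₀ + t`, ANY unit normal `n`, window `lo + 1 ≤ hi`, `ρ ≥ 1`:
  `2 φ(A⁻¹n) πρ² − 60√2π ρ ≤ innerBonds (A·Λ₀ + t) P (q ↦ hi < ⟪q, n⟫)` (pull-back of `innerBonds_fcc_offset_window` through
  the motion, as `stub_affineSampleDeficit` pulls back `sampleDeficit_offset_window`);
* **`innerBonds_plate_lower`** / **`innerBonds_plate_upper`** — the two plates of the wall cell VERBATIM: the lower plate
  `(A·Λ₀ + t) ∩ {−2R₀ ≤ p₂ ≤ −R₀, p₀² + p₁² ≤ ρ²}` with `beyond = (−R₀ < q₂)` and the upper plate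
  `(A·Λ₀ + t) ∩ {h + R₀ ≤ p₂ ≤ h + 2R₀, …}` with `beyond = (q₂ < h + R₀)`, `R₀ ≥ 1`, `ρ ≥ 1`:
  `2 φ(A⁻¹e₃) πρ² − 60√2π ρ ≤ innerBonds`, constant UNIFORM in `A, t, R₀, h` — so a uniform (R1) law stays uniform;
* **`bilayerWallAt_of_adhesionAt`** — the conversion: if `stacking Lᵢ sᵢ σᵢ = (Aᵢ· + sᵢ) '' Λ₀` (`i = 1, 2`), the table `c`
  charges the unit slice at most `q·πρ²` for `ρ ≥ R₀`, and the ADHESION-form inequality holds at `(C, R₀)` with charge `q` for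
  every clamped cell (F's matrix verbatim, `q` in place of `½√(1−⟪Le₃,e₃⟫²)`), then `BilayerWallAt (C + 60√2π) R₀ σ₁ σ₂ L₁ L₂
  s₁ s₂ c` (`R₀ ≥ 1`).  Per pair, with `(C, R₀)` explicit: whichever quantifier shape (xlv″) settles on for the F/G imports,
  uniform constants in give uniform constants out.
WHAT THIS IS NOT: not the `fam*Fcc` closers (their last line waits for the F sibling's name, cf-p1 (xlv″)); no upper face
count; F-C1 not moved.
-/

noncomputable section

open scoped BigOperators InnerProductSpace ENNReal
open MeasureTheory

namespace Summit.Ventures.Crystal3D.Theorems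

open Summit.Ventures.Crystal3D Finset
open Summit.Ventures.Crystal3D.Cruxes.TextureLiminf.TexShadow (E3 innerBonds cyl stacking laySlab BilayerWallAt)
open Literature.MathematicalPhysics.StatisticalMechanics (fccStacking contactDeficiency)

/-- **`innerBonds` under a rigid motion.**  For an isometry `g` with a right inverse `ginv`: the inner bonds of
the plate `P` in the moved stacking `g '' S` beyond `B` are those of the pulled-back plate `ginv '' P` in `S` beyond
`B ∘ g`. -/
theorem innerBonds_image_of_isometry {g ginv : E3 → E3} (hg : Isometry g) (hg_ginv : ∀ p, g (ginv p) = p)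
    (S : Set E3) (P : Finset E3) (B : E3 → Prop) :
    innerBonds (g '' S) P B = innerBonds S (P.image ginv) (fun q => B (g q)) := by
  classical
  unfold innerBonds
  have hginj : Function.Injective ginv := fun p q h => by rw [← hg_ginv p, ← hg_ginv q, h]
  rw [Finset.sum_image fun p _ q _ h => hginj h]
  refine Finset.sum_congr rfl fun p _ => ?_
  have hset : {q : E3 | q ∈ g '' S ∧ dist p q = 1 ∧ B q} =
      g '' {q' : E3 | q' ∈ S ∧ dist (ginv p) q' = 1 ∧ B (g q')} := by
    ext q
    constructor
    · rintro ⟨⟨q', hq'S, rfl⟩, hd, hB⟩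
      refine ⟨q', ⟨hq'S, ?_, hB⟩, rfl⟩
      rw [← hg.dist_eq, hg_ginv]; exact hd
    · rintro ⟨q', ⟨hq'S, hd, hB⟩, rfl⟩
      refine ⟨⟨q', hq'S, rfl⟩, ?_, hB⟩
      rw [← hg.dist_eq, hg_ginv] at hd; exact hd
  rw [hset, Set.ncard_image_of_injective _ hg.injective]

/-- **The inner-face count for a MOVED lattice and an arbitrary unit normal.**  For `A·Λ₀ + t`, `‖n‖ = 1`, a window
`lo + 1 ≤ hi` and `ρ ≥ 1`: the plate `P = (A·Λ₀ + t) ∩ {lo ≤ ⟪p, n⟫ ≤ hi, ‖p‖² − ⟪p, n⟫² ≤ ρ²}` has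
`2 φ(A⁻¹n) πρ² − 60√2π ρ ≤ innerBonds (A·Λ₀ + t) P (q ↦ hi < ⟪q, n⟫)`. -/
theorem innerBonds_affine_window (A : E3 ≃ₗᵢ[ℝ] E3) (t n : E3) (hn : ‖n‖ = 1) (lo hi ρ : ℝ) (hlo : lo + 1 ≤ hi)
    (hρ : 1 ≤ ρ) (P : Finset E3)
    (hP : ∀ p, p ∈ P ↔ (p ∈ (fun q => A q + t) '' fccStacking 1 (Real.sqrt (2 / 3)) ∧ lo ≤ ⟪p, n⟫_ℝ ∧
      ⟪p, n⟫_ℝ ≤ hi ∧ ‖p‖ ^ 2 - ⟪p, n⟫_ℝ ^ 2 ≤ ρ ^ 2)) :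
    2 * (Real.sqrt 2 / 4 * ∑ᶠ w ∈ {w ∈ fccStacking 1 (Real.sqrt (2 / 3)) | ‖w‖ = 1}, |⟪w, A.symm n⟫_ℝ|) *
        Real.pi * ρ ^ 2 - 60 * Real.sqrt 2 * Real.pi * ρ ≤
      innerBonds ((fun q => A q + t) '' fccStacking 1 (Real.sqrt (2 / 3))) P (fun q => hi < ⟪q, n⟫_ℝ) := by
  classical
  set ν : E3 := A.symm n with hν
  set s : E3 := A.symm t with hs
  have hνn : ‖ν‖ = 1 := by rw [hν, LinearIsometryEquiv.norm_map, hn]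
  have hAν : A ν = n := by rw [hν, LinearIsometryEquiv.apply_symm_apply]
  have hAs : A s = t := by rw [hs, LinearIsometryEquiv.apply_symm_apply]
  -- the motion and its inverse
  set g : E3 → E3 := fun q => A q + t with hg
  set ginv : E3 → E3 := fun p => A.symm (p - t) with hginv
  have hg_ginv : ∀ p, g (ginv p) = p := by
    intro p; simp only [hg, hginv, LinearIsometryEquiv.apply_symm_apply]; abel
  have hginv_g : ∀ q, ginv (g q) = q := by
    intro q; simp only [hg, hginv, add_sub_cancel_right, LinearIsometryEquiv.symm_apply_apply]
  have hg_iso : Isometry g := by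
    intro p q
    simp only [hg, edist_dist, dist_add_right, LinearIsometryEquiv.dist_map]
  have hgq : ∀ q, g q = A (q + s) := by
    intro q; simp only [hg, map_add, hAs]
  have h2 : ∀ q, ⟪g q, n⟫_ℝ = ⟪q + s, ν⟫_ℝ := by
    intro q; rw [hgq, ← hAν, LinearIsometryEquiv.inner_map_map]
  have hlat : ∀ q, ‖g q‖ ^ 2 - ⟪g q, n⟫_ℝ ^ 2 = ‖q + s‖ ^ 2 - ⟪q + s, ν⟫_ℝ ^ 2 := by
    intro q; rw [h2, hgq, LinearIsometryEquiv.norm_map]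
  -- the pulled-back sample
  set P' : Finset E3 := P.image ginv with hP'
  have hmemP' : ∀ q, q ∈ P' ↔ g q ∈ P := by
    intro q
    rw [hP', mem_image]
    constructor
    · rintro ⟨p, hp, rfl⟩
      rw [hg_ginv]; exact hp
    · intro hq
      exact ⟨g q, hq, hginv_g q⟩
  have hP'iff : ∀ q, q ∈ P' ↔ (q ∈ fccStacking 1 (Real.sqrt (2 / 3)) ∧ lo ≤ ⟪q + s, ν⟫_ℝ ∧
      ⟪q + s, ν⟫_ℝ ≤ hi ∧ ‖q + s‖ ^ 2 - ⟪q + s, ν⟫_ℝ ^ 2 ≤ ρ ^ 2) := by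
    intro q
    rw [hmemP', hP (g q), hlat, h2]
    have himg : g q ∈ (fun q => A q + t) '' fccStacking 1 (Real.sqrt (2 / 3)) ↔
        q ∈ fccStacking 1 (Real.sqrt (2 / 3)) := by
      constructor
      · rintro ⟨q', hq', hqq'⟩
        have : q' = q := by
          have h1 : ginv (g q') = ginv (g q) := congrArg ginv hqq'
          rwa [hginv_g, hginv_g] at h1
        rw [← this]; exact hq'
      · intro hq
        exact ⟨q, hq, rfl⟩
    rw [himg]
  have hbound := innerBonds_fcc_offset_window ν hνn s lo hi ρ hlo hρ P' hP'iff
  have hIB := innerBonds_image_of_isometry hg_iso hg_ginv (fccStacking 1 (Real.sqrt (2 / 3))) P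
    (fun q => hi < ⟪q, n⟫_ℝ)
  have hB : (fun q => hi < ⟪g q, n⟫_ℝ) = fun q => hi < ⟪q + s, ν⟫_ℝ := by
    funext q; rw [h2]
  rw [hIB, hB]
  exact hbound

/-- `⟪p, e₃⟫ = p₂`. -/
theorem euclidean3_inner_single_two (p : E3) : ⟪p, EuclideanSpace.single (2 : Fin 3) (1 : ℝ)⟫_ℝ = p 2 := by
  rw [EuclideanSpace.inner_single_right]; simp

/-- **Glue (a), LOWER plate of the wall cell.**  For a moved fcc lattice `A·Λ₀ + t`, `R₀ ≥ 1`, `ρ ≥ 1`: the clamped plate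
`P = (A·Λ₀ + t) ∩ {−2R₀ ≤ p₂ ≤ −R₀, p₀² + p₁² ≤ ρ²}` has at least `2 φ(A⁻¹e₃) πρ² − 60√2π ρ` stacking bonds to lattice
sites strictly above its inner face `p₂ = −R₀` — i.e. `φ(A⁻¹e₃)·πρ² ≤ ½·innerBonds + 30√2π·ρ`, uniform in `A, t, R₀`. -/
theorem innerBonds_plate_lower (A : E3 ≃ₗᵢ[ℝ] E3) (t : E3) (R₀ ρ : ℝ) (hR₀ : 1 ≤ R₀) (hρ : 1 ≤ ρ) (P : Finset E3)
    (hP : ∀ p, p ∈ P ↔ (p ∈ (fun q => A q + t) '' fccStacking 1 (Real.sqrt (2 / 3)) ∧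
      -(2 * R₀) ≤ p 2 ∧ p 2 ≤ -R₀ ∧ p 0 ^ 2 + p 1 ^ 2 ≤ ρ ^ 2)) :
    2 * (Real.sqrt 2 / 4 * ∑ᶠ w ∈ {w ∈ fccStacking 1 (Real.sqrt (2 / 3)) | ‖w‖ = 1},
        |⟪w, A.symm (EuclideanSpace.single (2 : Fin 3) (1 : ℝ))⟫_ℝ|) * Real.pi * ρ ^ 2 -
        60 * Real.sqrt 2 * Real.pi * ρ ≤
      innerBonds ((fun q => A q + t) '' fccStacking 1 (Real.sqrt (2 / 3))) P (fun q => -R₀ < q 2) := by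
  set e₃ : E3 := EuclideanSpace.single (2 : Fin 3) (1 : ℝ) with he₃
  have he₃n : ‖e₃‖ = 1 := by rw [he₃, PiLp.norm_single, norm_one]
  have hP' : ∀ p, p ∈ P ↔ (p ∈ (fun q => A q + t) '' fccStacking 1 (Real.sqrt (2 / 3)) ∧
      -(2 * R₀) ≤ ⟪p, e₃⟫_ℝ ∧ ⟪p, e₃⟫_ℝ ≤ -R₀ ∧ ‖p‖ ^ 2 - ⟪p, e₃⟫_ℝ ^ 2 ≤ ρ ^ 2) := by
    intro p; rw [hP p, ← sq_add_sq_eq_norm_sq_sub p, he₃, euclidean3_inner_single_two]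
  have h := innerBonds_affine_window A t e₃ he₃n (-(2 * R₀)) (-R₀) ρ (by linarith) hρ P hP'
  have hB : (fun q : E3 => -R₀ < ⟪q, e₃⟫_ℝ) = fun q => -R₀ < q 2 := by
    funext q; rw [he₃, euclidean3_inner_single_two]
  rw [hB] at h
  exact h

/-- **Glue (a), UPPER plate of the wall cell.**  For a moved fcc lattice `A·Λ₀ + t`, `R₀ ≥ 1`, `ρ ≥ 1` and any gap `h`:
the clamped plate `P = (A·Λ₀ + t) ∩ {h + R₀ ≤ p₂ ≤ h + 2R₀, p₀² + p₁² ≤ ρ²}` has at least `2 φ(A⁻¹e₃) πρ² − 60√2π ρ`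
stacking bonds to lattice sites strictly below its inner face `p₂ = h + R₀` (normal `−e₃`; `φ(−ν) = φ(ν)`). -/
theorem innerBonds_plate_upper (A : E3 ≃ₗᵢ[ℝ] E3) (t : E3) (h R₀ ρ : ℝ) (hR₀ : 1 ≤ R₀) (hρ : 1 ≤ ρ)
    (P : Finset E3)
    (hP : ∀ p, p ∈ P ↔ (p ∈ (fun q => A q + t) '' fccStacking 1 (Real.sqrt (2 / 3)) ∧
      h + R₀ ≤ p 2 ∧ p 2 ≤ h + 2 * R₀ ∧ p 0 ^ 2 + p 1 ^ 2 ≤ ρ ^ 2)) :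
    2 * (Real.sqrt 2 / 4 * ∑ᶠ w ∈ {w ∈ fccStacking 1 (Real.sqrt (2 / 3)) | ‖w‖ = 1},
        |⟪w, A.symm (EuclideanSpace.single (2 : Fin 3) (1 : ℝ))⟫_ℝ|) * Real.pi * ρ ^ 2 -
        60 * Real.sqrt 2 * Real.pi * ρ ≤
      innerBonds ((fun q => A q + t) '' fccStacking 1 (Real.sqrt (2 / 3))) P (fun q => q 2 < h + R₀) := by
  set e₃ : E3 := EuclideanSpace.single (2 : Fin 3) (1 : ℝ) with he₃
  have he₃n : ‖-e₃‖ = 1 := by rw [norm_neg, he₃, PiLp.norm_single, norm_one]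
  have hP' : ∀ p, p ∈ P ↔ (p ∈ (fun q => A q + t) '' fccStacking 1 (Real.sqrt (2 / 3)) ∧
      -(h + 2 * R₀) ≤ ⟪p, -e₃⟫_ℝ ∧ ⟪p, -e₃⟫_ℝ ≤ -(h + R₀) ∧ ‖p‖ ^ 2 - ⟪p, -e₃⟫_ℝ ^ 2 ≤ ρ ^ 2) := by
    intro p
    rw [hP p, inner_neg_right, neg_sq, ← sq_add_sq_eq_norm_sq_sub p, he₃, euclidean3_inner_single_two]
    constructor
    · rintro ⟨h0, h1, h2, h3⟩; exact ⟨h0, by linarith, by linarith, h3⟩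
    · rintro ⟨h0, h1, h2, h3⟩; exact ⟨h0, by linarith, by linarith, h3⟩
  have hw := innerBonds_affine_window A t (-e₃) he₃n (-(h + 2 * R₀)) (-(h + R₀)) ρ (by linarith) hρ P hP'
  have hB : (fun q : E3 => -(h + R₀) < ⟪q, -e₃⟫_ℝ) = fun q => q 2 < h + R₀ := by
    funext q; rw [inner_neg_right, he₃, euclidean3_inner_single_two]; exact propext ⟨fun h1 => by linarith, fun h1 => by linarith⟩
  have hφ : (∑ᶠ w ∈ {w ∈ fccStacking 1 (Real.sqrt (2 / 3)) | ‖w‖ = 1}, |⟪w, A.symm (-e₃)⟫_ℝ|) =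
      ∑ᶠ w ∈ {w ∈ fccStacking 1 (Real.sqrt (2 / 3)) | ‖w‖ = 1}, |⟪w, A.symm e₃⟫_ℝ| := by
    refine finsum_congr fun w => finsum_congr fun _ => ?_
    rw [map_neg, inner_neg_right, abs_neg]
  rw [hB, hφ] at hw
  exact hw

/-- **The ADHESION ⇒ `BilayerWallAt` currency conversion at explicit `(C, R₀)`** (per pair; uniform in ⇒ uniform out).
If both presented plates are affine fcc lattices (`stacking Lᵢ sᵢ σᵢ = (Aᵢ· + sᵢ) '' Λ₀`, cf. `exists_affine_fcc_pair_of_bothFcc`),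
the table `c` charges the unit slice at most `q·πρ²` (`ρ ≥ R₀`; glue (b), e.g. `tsum_charge_le_half_sin`), and the adhesion
inequality `cross₁ + cross₂ ≤ D(Y) + (φ₁ + φ₂ − q)πρ² + C(1+h)ρ` holds in every clamped cell at `(C, R₀)`, `R₀ ≥ 1` (lane F's
`CoaxialTwoSlabAdhesion` matrix VERBATIM with `q` for `½√(1−⟪Le₃,e₃⟫²)`; lane G's `TwoSlabLedgerAt` matrix with `q = c`), then
`BilayerWallAt (C + 60√2π) R₀ σ₁ σ₂ L₁ L₂ s₁ s₂ c`. -/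
theorem bilayerWallAt_of_adhesionAt {σ₁ σ₂ : ℤ → ℤ} {L₁ L₂ A₁ A₂ : E3 ≃ₗᵢ[ℝ] E3} {s₁ s₂ : E3}
    (hS₁ : stacking L₁ s₁ σ₁ = (fun q => A₁ q + s₁) '' fccStacking 1 (Real.sqrt (2 / 3)))
    (hS₂ : stacking L₂ s₂ σ₂ = (fun q => A₂ q + s₂) '' fccStacking 1 (Real.sqrt (2 / 3)))
    {c : ℤ → ℤ → ℝ} {C R₀ q : ℝ} (hR₀ : 1 ≤ R₀)
    (hcap : ∀ ρ : ℝ, R₀ ≤ ρ →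
      ∑' ij : ℤ × ℤ, c ij.1 ij.2 *
          (volume ({y : E3 | 0 ≤ y 2 ∧ y 2 ≤ 1 ∧ y 0 ^ 2 + y 1 ^ 2 ≤ ρ ^ 2} ∩
            laySlab L₁ s₁ ij.1 ∩ laySlab L₂ s₂ ij.2)).toReal ≤ q * (Real.pi * ρ ^ 2))
    (hadh : ∀ h : ℝ, 0 ≤ h → ∀ ρ : ℝ, R₀ ≤ ρ → ∀ X P₁ P₂ : Finset E3,
      (∀ p ∈ X, ∀ p' ∈ X, p ≠ p' → 1 ≤ dist p p') → P₁ ⊆ X → P₂ ⊆ X \ P₁ →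
      (∀ p ∈ X, -(2 * R₀) ≤ p 2 ∧ p 2 ≤ h + 2 * R₀ ∧ p 0 ^ 2 + p 1 ^ 2 ≤ ρ ^ 2) →
      (∀ p, p ∈ P₁ ↔ (p ∈ (fun q => A₁ q + s₁) '' fccStacking 1 (Real.sqrt (2 / 3)) ∧
        -(2 * R₀) ≤ p 2 ∧ p 2 ≤ -R₀ ∧ p 0 ^ 2 + p 1 ^ 2 ≤ ρ ^ 2)) →
      (∀ p, p ∈ P₂ ↔ (p ∈ (fun q => A₂ q + s₂) '' fccStacking 1 (Real.sqrt (2 / 3)) ∧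
        h + R₀ ≤ p 2 ∧ p 2 ≤ h + 2 * R₀ ∧ p 0 ^ 2 + p 1 ^ 2 ≤ ρ ^ 2)) →
      ((((P₁ ×ˢ (X \ P₁)).filter fun pq => dist pq.1 pq.2 = 1).card : ℕ) : ℝ) +
        ((((P₂ ×ˢ ((X \ P₁) \ P₂)).filter fun pq => dist pq.1 pq.2 = 1).card : ℕ) : ℝ) ≤
        contactDeficiency ((X \ P₁) \ P₂) +
          (Real.sqrt 2 / 4 * ∑ᶠ w ∈ {w ∈ fccStacking 1 (Real.sqrt (2 / 3)) | ‖w‖ = 1},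
              |⟪w, A₁.symm (EuclideanSpace.single (2 : Fin 3) (1 : ℝ))⟫_ℝ| +
            Real.sqrt 2 / 4 * ∑ᶠ w ∈ {w ∈ fccStacking 1 (Real.sqrt (2 / 3)) | ‖w‖ = 1},
              |⟪w, A₂.symm (EuclideanSpace.single (2 : Fin 3) (1 : ℝ))⟫_ℝ| - q) * Real.pi * ρ ^ 2 +
          C * (1 + h) * ρ) :
    BilayerWallAt (C + 60 * Real.sqrt 2 * Real.pi) R₀ σ₁ σ₂ L₁ L₂ s₁ s₂ c := by
  intro h hh ρ hρ X P₁ P₂ hX hP₁X hP₂X hcyl hP₁ hP₂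
  have hρ1 : 1 ≤ ρ := hR₀.trans hρ
  have hP₁' : ∀ p, p ∈ P₁ ↔ (p ∈ (fun q => A₁ q + s₁) '' fccStacking 1 (Real.sqrt (2 / 3)) ∧
      -(2 * R₀) ≤ p 2 ∧ p 2 ≤ -R₀ ∧ p 0 ^ 2 + p 1 ^ 2 ≤ ρ ^ 2) := fun p => by rw [← hS₁]; exact hP₁ p
  have hP₂' : ∀ p, p ∈ P₂ ↔ (p ∈ (fun q => A₂ q + s₂) '' fccStacking 1 (Real.sqrt (2 / 3)) ∧
      h + R₀ ≤ p 2 ∧ p 2 ≤ h + 2 * R₀ ∧ p 0 ^ 2 + p 1 ^ 2 ≤ ρ ^ 2) := fun p => by rw [← hS₂]; exact hP₂ p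
  have key := hadh h hh ρ hρ X P₁ P₂ hX hP₁X hP₂X (fun p hp => hcyl p hp) hP₁' hP₂'
  have ib₁ := innerBonds_plate_lower A₁ s₁ R₀ ρ hR₀ hρ1 P₁ hP₁'
  have ib₂ := innerBonds_plate_upper A₂ s₂ h R₀ ρ hR₀ hρ1 P₂ hP₂'
  rw [← hS₁] at ib₁
  rw [← hS₂] at ib₂
  have hc := hcap ρ hρ
  have hρ0 : 0 ≤ ρ := by linarith
  have hextra : 60 * Real.sqrt 2 * Real.pi * ρ ≤ 60 * Real.sqrt 2 * Real.pi * (1 + h) * ρ := by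
    have h1 : 0 ≤ 60 * Real.sqrt 2 * Real.pi * h * ρ := by positivity
    nlinarith
  have hsplit : (C + 60 * Real.sqrt 2 * Real.pi) * (1 + h) * ρ =
      C * (1 + h) * ρ + 60 * Real.sqrt 2 * Real.pi * (1 + h) * ρ := by ring
  rw [hsplit]
  linarith [key, ib₁, ib₂, hc, hextra]

end Summit.Ventures.Crystal3D.Theorems

end
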